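import Summits.ABC.IUTFork.Thm311RealDegree
import Literature.IUT.LogThetaLattice.PacketLogVolumesHaarModelCapsulesDHBridge
import Literature.IUT.LogThetaLattice.PacketLogVolumesHaarModelCapsulesDegree
import HarnessLib

/-!
# JUNCTION: the Cor. 3.12 crew's real-setting log-volume container at `(j, p)` (abc-iut-c312-1 `Real.padicPresentationPr`,
# probability weights × Dupuy–Hilado `log μ̄`) IS the layer-L6 GENUINE model of [IUTchIII] Prop. 3.9 (i)/(iii) for the
# capsule `A = S^±_{j+1}` (abc-iut-L6-d3 `nonarchPortion` / `capsulePacketLogVolume`) — proof-only, summand by summand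

Record file (D-0012) of the abc-iut cell (layer L6, seat abc-iut-L6-d3, gen 4; row «CAP39», abc-iut-L6-lead §F v1.19d
(2) «GO L6-d3 g4: the c312 junction, PROOF-ONLY»). TAKES NO SIDE on [IUTchIII] Cor. 3.12; an identification of two of
OUR containers, not an endorsement of either reading of the disputed text.

THE TWO CONTAINERS. (C312) abc-iut-c312-1 gen 5, `Thm311RealDegree.lean` (p417577): at a prime `p` the verbatim
mono-analytic container of [IUTchIII] Rmk. 3.1.1 (ii)(iii) / Prop. 3.9 (i) for the typed Thm. 3.11 premise is the
`PadicPresentation` `Real.padicPresentationPr X p logv hlog` — summands `X_{v⃗} = F_{v_0} ⊗_{ℚ_p} ⋯ ⊗_{ℚ_p} F_{v_j}`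
(campaign-S `PacketAlgebra` over abc-iut-S7's rescaled completions `kOf X p`), admissibility `PacketAdm` and log-measure
`packetLogμ` of abc-iut-c312-3 (Dupuy–Hilado's normalised `log μ̄` through a chosen decomposition), weights
`weightPr = ∏_a weight F v_a` (the probability weights `Pr(v⃗) = ∏ n_{v_a}/[F:ℚ]`), packet log-volume on direct product
regions `Σ_{v⃗} w(v⃗)·log μ̄_{v⃗}(A_{v⃗})` (c312-5 `SummandPieces.logvol`). (L6) abc-iut-L6-d3 gen 4, the genuine capsule
model of Prop. 3.9 (p418604 `nonarchPortion`, p419250 `capsulePacketLogVolume`/`placeProbWeight`/`portionWeight`,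
p419946 degree, p421286 `packetAdm_iff_haar`/`nonarchPortion_logVol_eq_packetLogμ`): portions `⊗_{α∈A} F_{v_α}` over the
SAME rescaled completions (`Kp`), admissibility = positive finite Haar measure, `μ^log` = abc-iut-S7's INTRINSIC
`tensorLogVolume`, weights `∏_α n_{v_α}/[F:ℚ]`.

WHAT IS PROVED (all at `A := S^±_{j+1} = (thetaIndex X).Caps j`, `v⃗ ↦ (placeOf X p (e a))_a`):
* **`toLocalPieces_X_eq`** — the summand TYPES coincide (`rfl`: same `PacketAlgebra` over the same `RescaledCompletion`s);
* **`toLocalPieces_adm_iff`** — c312's `adm` = L6's `IsAdm` (p421286 `packetAdm_iff_haar`);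
* **`toLocalPieces_logμ_eq`** — on admissible sets c312's `log μ̄` = L6's `μ^log` (campaign-S `packetLogμ_eq_tensorLogVolume`);
* **`padicPresentationPr_w_eq`** — c312-1's `weightPr(v⃗)` = L6's `∏_a placeProbWeight(v_a)` (`rfl`);
* **`summandPiecesPr_logvol_preimage_pi`** — the c312 packet log-volume of a direct product region `e⁻¹(Π_{v⃗} R_{v⃗})`
  at `v_ℚ = p` equals `Σ_{v⃗} (∏_a placeProbWeight(v_a)) · μ^log_{L6,v⃗}(R_{v⃗})`: the L6 weighted sum of genuine portion
  log-volumes — i.e. [IUTchIII] Prop. 3.9 (i)'s `μ^log_{A,p}` as typed by L6 (`capsulePacketLogVolume`, whose portions are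
  indexed by the equinumerous `Portion F A p`; the re-indexing `(T.Caps j → T.Fibre p) ↔ Portion` is bookkeeping left to
  consumers, the summand data being identified on the nose here);
* **`nonarchPortion_logVol_idealBox`** — c312-1's box `ι_j(ϖ^{−c})·(R_{v⃗})^∼` of a fractional ideal has L6 log-volume
  `c·log|κ(v_j)|/n_{v_j}` — the SAME number as L6's own region of `𝔍` in a label (p419946
  `nonarchPortion_logVol_idealPortionRegion`): the two degree computations agree summand by summand.
So the sentence «the real-setting log-volume of the typed Thm. 3.11 (i)(c) premise at `(j,p)` is [IUTchIII] Prop. 3.9's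
genuine `μ^log_{S^±_{j+1},p}`» is a kernel fact. No new definition; nothing of the c312-1, c312-3, c312-5 or campaign-S files is
restated; consumers cite both sides BY NAME. [claim: Mochizuki2012, status: disputed] for the quoted items;
[cite: DupuyHilado2025, Def. 3.6.1, §3.6, §3.7]. typed ≠ proved; instantiated ≠ endorsed.
-/

noncomputable section

open Set Function NumberField IsDedekindDomain
open scoped Pointwise

namespace Summit.ABC.IUTFork.Thm311.Real

open Cor312Vol Literature.IUT.LogThetaLattice Literature.IUT.LogVolume Literature.NumberTheory.NumberFields

variable {F : Type} [Field F] [NumberField F] (X : PilotData F) (p : ℕ) [hp : Fact p.Prime]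
variable (logv : PadicLogs F) (hlog : LogvAnalyticAt p logv)

/-! ## 1. Summand by summand: carriers, admissibility, log-measures, weights -/

/-- **The summand types coincide**: c312's `X_{v⃗}` at the tuple `e : S^±_{j+1} → {v | p}` IS L6's portion carrier
`⊗_{a} F_{v_a}` at `v⃗ = (placeOf (e a))_a` (the same `PacketAlgebra` over the same rescaled completions).
[cite: DupuyHilado2025, Def. 3.6.1] -/
theorem toLocalPieces_X_eq (j : (thetaIndex X).Label)
    (e : (thetaIndex X).Caps j → (thetaIndex X).Fibre (.inr (ratPrime p))) :
    (padicPresentationPr X p logv hlog).toLocalPieces.X j e =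
      (nonarchPortion F ((thetaIndex X).Caps j) (ratPrime p)
        (fun a => ⟨placeOf X p (e a), placeOf_mem X p (e a)⟩)).X := rfl

/-- **c312's admissibility IS L6's** (`PacketAdm` = positive finite Haar measure, abc-iut-L6-d3 `packetAdm_iff_haar`).
[cite: DupuyHilado2025, Def. 3.5.1] -/
theorem toLocalPieces_adm_iff (j : (thetaIndex X).Label)
    (e : (thetaIndex X).Caps j → (thetaIndex X).Fibre (.inr (ratPrime p)))
    (R : Set ((padicPresentationPr X p logv hlog).X e)) :
    (padicPresentationPr X p logv hlog).toLocalPieces.adm j e R ↔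
      (nonarchPortion F ((thetaIndex X).Caps j) (ratPrime p)
        (fun a => ⟨placeOf X p (e a), placeOf_mem X p (e a)⟩)).IsAdm R :=
  packetAdm_iff_haar p _ R

/-- **On admissible sets c312's `log μ̄_{v⃗}` IS L6's `μ^log_{v⃗}`** (campaign-S `packetLogμ_eq_tensorLogVolume`: the
chosen-decomposition log-measure is the intrinsic one). [cite: DupuyHilado2025, Def. 3.6.1] -/
theorem toLocalPieces_logμ_eq (j : (thetaIndex X).Label)
    (e : (thetaIndex X).Caps j → (thetaIndex X).Fibre (.inr (ratPrime p)))
    {R : Set ((padicPresentationPr X p logv hlog).X e)}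
    (hR : (padicPresentationPr X p logv hlog).toLocalPieces.adm j e R) :
    (padicPresentationPr X p logv hlog).toLocalPieces.logμ j e R =
      (nonarchPortion F ((thetaIndex X).Caps j) (ratPrime p)
        (fun a => ⟨placeOf X p (e a), placeOf_mem X p (e a)⟩)).logVol R := by
  have h := (toLocalPieces_adm_iff X p logv hlog j e R).1 hR
  exact packetLogμ_eq_tensorLogVolume p _ h.1 h.2

/-- **c312-1's probability weight IS L6's portion weight**: `weightPr(v⃗) = ∏_a n_{v_a}/[F:ℚ] = ∏_a placeProbWeight(v_a)`.
[cite: DupuyHilado2025, §3.6] -/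
theorem padicPresentationPr_w_eq (j : (thetaIndex X).Label)
    (e : (thetaIndex X).Caps j → (thetaIndex X).Fibre (.inr (ratPrime p))) :
    (padicPresentationPr X p logv hlog).w j e = ∏ a, placeProbWeight F (Sum.inr (placeOf X p (e a))) := rfl

/-! ## 2. The packet log-volume at `p` on direct product regions -/

section Packet

variable {logv} (hlogAll : LogvAnalytic logv)

/-- The comparison map of c312-1's container at `v_ℚ = p` is the `p`-adic presentation's `comparison` (definitional).
[folklore] -/
theorem summandPiecesPr_e_inr (j : (thetaIndex X).Label) :
    (summandPiecesPr X hlogAll).e j (.inr (ratPrime p)) =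
      (padicPresentationPr X p logv (hlogAll (ratPrime p))).comparison j := rfl

/-- **The c312 packet log-volume of a direct product region IS the L6 weighted sum of genuine portion
log-volumes** — [IUTchIII] Prop. 3.9 (i)'s `μ^log_{S^±_{j+1},p}` as typed by layer L6 (`capsulePacketLogVolume` shape
`Σ_{v⃗} (∏_a placeProbWeight(v_a)) · μ^log_{v⃗}(R_{v⃗})`), for the verbatim container `Real.summandPiecesPr` of the typed
Thm. 3.11 premise (c312-5 `SummandPieces.logvol_preimage_pi` + §1). [claim: Mochizuki2012, status: disputed] -/
theorem summandPiecesPr_logvol_preimage_pi (j : (thetaIndex X).Label)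
    (R : ∀ e : (summandPiecesPr X hlogAll).E j (.inr (ratPrime p)),
      Set ((summandPiecesPr X hlogAll).X j (.inr (ratPrime p)) e))
    (hR : ∀ e, (summandPiecesPr X hlogAll).adm j (.inr (ratPrime p)) e (R e)) :
    (summandPiecesPr X hlogAll).logvol j (.inr (ratPrime p))
        ((summandPiecesPr X hlogAll).e j (.inr (ratPrime p)) ⁻¹' Set.pi univ R) =
      ∑ e : (summandPiecesPr X hlogAll).E j (.inr (ratPrime p)),
        (∏ a, placeProbWeight F (Sum.inr (placeOf X p (e a)))) *
        (nonarchPortion F ((thetaIndex X).Caps j) (ratPrime p)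
          (fun a : (thetaIndex X).Caps j =>
            (⟨placeOf X p (e a), placeOf_mem X p (e a)⟩ :
              {v : HeightOneSpectrum (𝓞 F) // v ∈ placesOver F (ratPrime p : ℕ)}))).logVol (R e) := by
  rw [(summandPiecesPr X hlogAll).logvol_preimage_pi j (.inr (ratPrime p)) hR]
  refine Finset.sum_congr rfl fun e _ => ?_
  exact congrArg₂ (· * ·) (padicPresentationPr_w_eq X p logv (hlogAll (ratPrime p)) j e)
    (toLocalPieces_logμ_eq X p logv (hlogAll (ratPrime p)) j e (hR e))

end Packet

/-! ## 3. The degree computation: c312-1's box and L6's region of `𝔍` have the same genuine log-volume -/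

/-- **c312-1's box `ι_j(ϖ^{−c})·(R_{v⃗})^∼` of the fractional ideal `𝔍 = Σ c_v[v]` has L6 log-volume
`c_{v_j}·log|κ(v_j)|/n_{v_j}`** (§1 + c312-1 `packetLogμ_idealBox`). [cite: DupuyHilado2025, §3.7] -/
theorem nonarchPortion_logVol_idealBox (J : HeightOneSpectrum (𝓞 F) →₀ ℤ) (j : (thetaIndex X).Label)
    (e : (thetaIndex X).Caps j → (thetaIndex X).Fibre (.inr (ratPrime p))) :
    (nonarchPortion F ((thetaIndex X).Caps j) (ratPrime p)
        (fun a => ⟨placeOf X p (e a), placeOf_mem X p (e a)⟩)).logVol (idealBox X p hlog J e) =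
      J (placeOf X p (e ((thetaIndex X).selfIndex j))) * logNorm F (placeOf X p (e ((thetaIndex X).selfIndex j))) /
        localDegree F (placeOf X p (e ((thetaIndex X).selfIndex j))) := by
  rw [← toLocalPieces_logμ_eq X p logv hlog j e (idealBox_adm X p hlog J e)]
  exact packetLogμ_idealBox X p hlog J e

/-- **… which is the SAME number as L6's own region of `𝔍` in the label `j`** (abc-iut-L6-d3 `nonarchIdealPortionRegion`
= `ι_α(ϖ_glob^{−c})·(R_I)^∼` with a GLOBAL uniformizer power, p419946 `nonarchPortion_logVol_idealPortionRegion`): the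
c312 degree clause (`Real.degreesViaLogvol_ofIdeals`) and the L6 degree clause (`prop39iii_degree_haarModelCapsules_general`)
compute the same local terms at every summand (`|S^±_{j+1}| ≥ 2`, i.e. `j ≥ 1`, for the L6 region).
[claim: Mochizuki2012, status: disputed] -/
theorem logVol_idealBox_eq_logVol_idealPortionRegion (J : HeightOneSpectrum (𝓞 F) →₀ ℤ) (j : (thetaIndex X).Label)
    (hA : 2 ≤ Fintype.card ((thetaIndex X).Caps j))
    (e : (thetaIndex X).Caps j → (thetaIndex X).Fibre (.inr (ratPrime p))) :
    (nonarchPortion F ((thetaIndex X).Caps j) (ratPrime p)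
        (fun a => ⟨placeOf X p (e a), placeOf_mem X p (e a)⟩)).logVol (idealBox X p hlog J e) =
      (nonarchPortion F ((thetaIndex X).Caps j) (ratPrime p)
        (fun a => ⟨placeOf X p (e a), placeOf_mem X p (e a)⟩)).logVol
        (nonarchIdealPortionRegion F ((thetaIndex X).Caps j) (ratPrime p)
          (fun a => ⟨placeOf X p (e a), placeOf_mem X p (e a)⟩) hA ((thetaIndex X).selfIndex j)
          (J (placeOf X p (e ((thetaIndex X).selfIndex j))))).1 := by
  rw [nonarchPortion_logVol_idealBox, nonarchPortion_logVol_idealPortionRegion]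

end Summit.ABC.IUTFork.Thm311.Real

end
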